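import Mathlib.GroupTheory.Abelianization.Defs
import Mathlib.GroupTheory.FreeGroup.Basic
import Mathlib.GroupTheory.QuotientGroup.Basic
import Mathlib.GroupTheory.Commutator.Basic
import Mathlib.Algebra.FreeAbelianGroup.Finsupp
import Mathlib.Data.Finsupp.SMulWithZero
import Mathlib.Tactic.Group
import HarnessLib

/-!
# Central extensions: lifting the vanishing of `ker ∩ [E, E]` from kernels of exponent `p` to kernels of
# exponent `p^a` (Hopf's formula argument)

Fix a group `G` and `p ≠ 0`.  Suppose that for EVERY central extension `π : E ↠ G` whose kernel has exponent
dividing `p`, `ker π ∩ [E, E] = 1`.  **Then the same holds for every central extension whose kernel has exponent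
dividing `p^a`** (`eq_one_of_forall_exponent`).  This is the classical mechanism behind Hopf's formula
`M(G) ≅ (R ∩ [F, F]) / [F, R]` for a free presentation `G = F/R` ([Rotman1995, Ch. 11, Hopf's formula];
Schur): with `C = [F, R]`, the group `F/C` is a central extension of `G` by `R/C` through which every central
extension factors; applying the hypothesis to `(F/C)/(R/C)^p` shows `M := (R ∩ [F,F])/C ⊆ (R/C)^p`, and since
`F^{ab}` is torsion-free (`pow_eq_one_abelianization_freeGroup`) in fact `M = M^p = M^{p^a}`; mapping to `E`
kills `M^{p^a}` because the kernel has exponent `p^a`.  No homology is used; the statement is in hypothesis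
form (no definitions).  It is used in the tree to pass from targets of exponent `p` to targets of `p`-power
exponent in the `SL₂(ℤ)`-invariant form of [CalegariDimitrovTang2025, Corollary 4.5.3] (`p = 3`, where
`SL₂(ℤ/3^e)` is not perfect and the perfectness shortcut is unavailable).
-/

open scoped commutatorElement

universe u v

namespace Literature.GroupTheory

namespace CentralExtensionExponentLift

/-- The abelianisation of a free group is torsion-free: `x ^ n = 1` with `n ≠ 0` forces `x = 1` in
`(FreeGroup α)^{ab} ≅ ℤ^{(α)}`. [cite: Rotman1995, Ch. 11, free abelian groups are torsion-free] -/
theorem pow_eq_one_abelianization_freeGroup {α : Type u} {n : ℕ} (hn : n ≠ 0)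
    {x : Abelianization (FreeGroup α)} (hx : x ^ n = 1) : x = 1 := by
  set y : FreeAbelianGroup α := Additive.ofMul x with hy_def
  have hy : n • y = 0 := by
    have h : n • y = (Additive.ofMul (x ^ n) : FreeAbelianGroup α) := rfl
    rw [h, hx]
    rfl
  have h1 : n • FreeAbelianGroup.equivFinsupp α y = 0 := by
    rw [← map_nsmul, hy, map_zero]
  have h2 : FreeAbelianGroup.equivFinsupp α y = 0 := by
    ext a
    have h3 := DFunLike.congr_fun h1 a
    simp only [Finsupp.smul_apply, Finsupp.coe_zero, Pi.zero_apply] at h3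
    rw [nsmul_eq_mul] at h3
    rcases mul_eq_zero.mp h3 with h | h
    · exact absurd (Nat.cast_eq_zero.mp h) hn
    · exact h
  have h4 : y = 0 := (FreeAbelianGroup.equivFinsupp α).injective (by rw [h2, map_zero])
  rw [hy_def] at h4
  exact ofMul_eq_zero.mp h4

/-- **Exponent lifting for central extensions (Hopf's formula argument).**  Let `G` be a group and `p ≠ 0`.
If every central extension `π : E ↠ G` with kernel of exponent dividing `p` satisfies
`ker π ∩ [E, E] = 1`, then so does every central extension with kernel of exponent dividing `p ^ a`.
(The universe of the test extensions is that of `E`; the free presentation `FreeGroup E` lives there.)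
[cite: Rotman1995, Ch. 11, Hopf's formula M(Q) ≅ (R ∩ F')/[F,R]] -/
theorem eq_one_of_forall_exponent {G : Type v} [Group G] {p : ℕ} (hp : p ≠ 0)
    (H : ∀ (E : Type u) [Group E] (π : E →* G), Function.Surjective π →
      (∀ z : E, π z = 1 → ∀ g : E, g * z = z * g) → (∀ z : E, π z = 1 → z ^ p = 1) →
      ∀ z : E, π z = 1 → z ∈ commutator E → z = 1)
    {E : Type u} [Group E] (π : E →* G) (hsurj : Function.Surjective π)
    (hcen : ∀ z : E, π z = 1 → ∀ g : E, g * z = z * g) (a : ℕ)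
    (hexp : ∀ z : E, π z = 1 → z ^ (p ^ a) = 1) {z : E} (hz : π z = 1)
    (hzc : z ∈ commutator E) : z = 1 := by
  -- Step 0: the free presentation `φ : F = FreeGroup E ↠ E`, `ρ = π ∘ φ : F ↠ G`, `R = ker ρ`, `C = [F, R]`.
  let φ : FreeGroup E →* E := FreeGroup.lift id
  have hφ : Function.Surjective φ := fun x ↦ ⟨FreeGroup.of x, FreeGroup.lift_apply_of⟩
  let ρ : FreeGroup E →* G := π.comp φ
  have hρ : Function.Surjective ρ := hsurj.comp hφ
  let R : Subgroup (FreeGroup E) := ρ.ker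
  haveI hRn : R.Normal := MonoidHom.normal_ker ρ
  let C : Subgroup (FreeGroup E) := ⁅(⊤ : Subgroup (FreeGroup E)), R⁆
  haveI hCn : C.Normal := Subgroup.commutator_normal ⊤ R
  have hCR : C ≤ R := Subgroup.commutator_le_right ⊤ R
  have hCcomm : C ≤ commutator (FreeGroup E) := by
    rw [commutator_def]
    exact Subgroup.commutator_mono le_top le_top
  have hCφ : C ≤ φ.ker := by
    show ⁅(⊤ : Subgroup (FreeGroup E)), R⁆ ≤ φ.ker
    rw [Subgroup.commutator_le]
    intro f _ r hr
    have hr' : π (φ r) = 1 := hr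
    rw [MonoidHom.mem_ker, map_commutatorElement, commutatorElement_def, hcen (φ r) hr' (φ f),
      mul_inv_cancel_right, mul_inv_cancel]
  -- Step 1: `F̃ = F / C`, in which `R̃ = R / C` is central.
  let mk : FreeGroup E →* FreeGroup E ⧸ C := QuotientGroup.mk' C
  let Rt : Subgroup (FreeGroup E ⧸ C) := R.map mk
  have hRt_central : ∀ x ∈ Rt, ∀ y : FreeGroup E ⧸ C, y * x = x * y := by
    intro x hx y
    obtain ⟨r, hr, rfl⟩ := Subgroup.mem_map.mp hx
    obtain ⟨f, rfl⟩ := QuotientGroup.mk'_surjective C y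
    rw [← map_mul, ← map_mul]
    show ((f * r : FreeGroup E) : FreeGroup E ⧸ C) = ((r * f : FreeGroup E) : FreeGroup E ⧸ C)
    rw [QuotientGroup.eq]
    have h : (f * r)⁻¹ * (r * f) = ⁅r⁻¹, f⁻¹⁆ := by
      rw [commutatorElement_def]
      group
    rw [h]
    show ⁅r⁻¹, f⁻¹⁆ ∈ ⁅(⊤ : Subgroup (FreeGroup E)), R⁆
    rw [Subgroup.commutator_comm]
    exact Subgroup.commutator_mem_commutator (R.inv_mem hr) (Subgroup.mem_top _)
  -- Step 2: the subgroup `P = R̃^p` of `p`-th powers (a subgroup since `R̃` is central), normal in `F̃`.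
  let P : Subgroup (FreeGroup E ⧸ C) :=
    { carrier := {y | ∃ x ∈ Rt, x ^ p = y}
      one_mem' := ⟨1, one_mem _, one_pow _⟩
      mul_mem' := by
        rintro _ _ ⟨x, hx, rfl⟩ ⟨y, hy, rfl⟩
        refine ⟨x * y, mul_mem hx hy, ?_⟩
        have hc : Commute x y := (hRt_central y hy x)
        exact hc.mul_pow p
      inv_mem' := by
        rintro _ ⟨x, hx, rfl⟩
        exact ⟨x⁻¹, inv_mem hx, by rw [inv_pow]⟩ }
  have hPmem : ∀ y, y ∈ P ↔ ∃ x ∈ Rt, x ^ p = y := fun y ↦ Iff.rfl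
  haveI hPn : P.Normal := ⟨by
    intro y hy g
    obtain ⟨x, hx, rfl⟩ := (hPmem y).mp hy
    refine (hPmem _).mpr ⟨x, hx, ?_⟩
    rw [hRt_central _ (pow_mem hx p) g, mul_inv_cancel_right]⟩
  -- Step 3: `ρ̃ : F̃ → G` and `ρ₁ : F̃ / P → G`; the latter is a central extension with kernel of exponent `p`.
  have hCρ : C ≤ ρ.ker := hCR
  let ρt : FreeGroup E ⧸ C →* G := QuotientGroup.lift C ρ hCρ
  have hρt : ∀ f, ρt (mk f) = ρ f := fun f ↦ rfl
  have hker_ρt : ∀ y, ρt y = 1 → y ∈ Rt := by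
    intro y hy
    obtain ⟨f, rfl⟩ := QuotientGroup.mk'_surjective C y
    exact Subgroup.mem_map.mpr ⟨f, by rw [hρt] at hy; exact hy, rfl⟩
  have hPρt : P ≤ ρt.ker := by
    intro y hy
    obtain ⟨x, hx, rfl⟩ := (hPmem y).mp hy
    obtain ⟨f, hf, rfl⟩ := Subgroup.mem_map.mp hx
    have hf' : ρ f = 1 := hf
    rw [MonoidHom.mem_ker, map_pow, hρt, hf', one_pow]
  let ρ₁ : (FreeGroup E ⧸ C) ⧸ P →* G := QuotientGroup.lift P ρt hPρt
  have h1surj : Function.Surjective ρ₁ := by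
    intro g
    obtain ⟨f, rfl⟩ := hρ g
    exact ⟨QuotientGroup.mk' P (mk f), rfl⟩
  have h1cen : ∀ w, ρ₁ w = 1 → ∀ g, g * w = w * g := by
    intro w hw g
    obtain ⟨y, rfl⟩ := QuotientGroup.mk'_surjective P w
    obtain ⟨y', rfl⟩ := QuotientGroup.mk'_surjective P g
    rw [← map_mul, ← map_mul, hRt_central y (hker_ρt y hw) y']
  have h1exp : ∀ w, ρ₁ w = 1 → w ^ p = 1 := by
    intro w hw
    obtain ⟨y, rfl⟩ := QuotientGroup.mk'_surjective P w
    rw [← map_pow, QuotientGroup.mk'_apply, QuotientGroup.eq_one_iff]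
    exact (hPmem _).mpr ⟨y, hker_ρt y hw, rfl⟩
  -- Step 4: `M̃ := (R ∩ [F,F]) / C` satisfies `M̃ ⊆ M̃^p` (hypothesis `H` on `F̃ / P` + torsion-freeness of
  -- `F^{ab}`), hence `M̃ ⊆ M̃^{p^n}` for all `n`.
  let Mt : Subgroup (FreeGroup E ⧸ C) := (R ⊓ commutator (FreeGroup E)).map mk
  have hD : ∀ y ∈ Mt, ∃ x ∈ Mt, x ^ p = y := by
    intro y hy
    obtain ⟨c, hc, rfl⟩ := Subgroup.mem_map.mp hy
    obtain ⟨hcR, hcc⟩ := Subgroup.mem_inf.mp hc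
    have hw1 : ρ₁ (QuotientGroup.mk' P (mk c)) = 1 := hcR
    have hwc : QuotientGroup.mk' P (mk c) ∈ commutator ((FreeGroup E ⧸ C) ⧸ P) := by
      have h := Subgroup.mem_map_of_mem ((QuotientGroup.mk' P).comp mk) hcc
      rw [map_commutator_eq] at h
      exact Subgroup.commutator_mono le_top le_top h
    have hw := H _ ρ₁ h1surj h1cen h1exp _ hw1 hwc
    rw [QuotientGroup.mk'_apply, QuotientGroup.eq_one_iff] at hw
    obtain ⟨x, hx, hxc⟩ := (hPmem _).mp hw
    obtain ⟨f, hfR, rfl⟩ := Subgroup.mem_map.mp hx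
    refine ⟨mk f, Subgroup.mem_map_of_mem mk (Subgroup.mem_inf.mpr ⟨hfR, ?_⟩), hxc⟩
    -- `f ∈ [F, F]`: `f^p ≡ c (mod C)`, `C ⊆ [F,F]`, `c ∈ [F,F]`, and `F^{ab}` is torsion-free.
    have h1 : (f ^ p)⁻¹ * c ∈ C := by
      rw [← QuotientGroup.eq]
      have h' : mk (f ^ p) = mk c := by rw [map_pow]; exact hxc
      exact h'
    have h2 : f ^ p ∈ commutator (FreeGroup E) := by
      have h3 := hCcomm h1
      have h4 : f ^ p = c * ((f ^ p)⁻¹ * c)⁻¹ := by group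
      rw [h4]
      exact mul_mem hcc (inv_mem h3)
    have h5 : Abelianization.of f ^ p = (1 : Abelianization (FreeGroup E)) := by
      rw [← map_pow, ← MonoidHom.mem_ker, Abelianization.ker_of]
      exact h2
    have h6 : f ∈ (Abelianization.of : FreeGroup E →* Abelianization (FreeGroup E)).ker :=
      pow_eq_one_abelianization_freeGroup hp h5
    rwa [Abelianization.ker_of] at h6
  have hDa : ∀ n : ℕ, ∀ y ∈ Mt, ∃ x ∈ Mt, x ^ (p ^ n) = y := by
    intro n
    induction n with
    | zero =>
      intro y hy
      exact ⟨y, hy, by rw [pow_zero, pow_one]⟩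
    | succ n ih =>
      intro y hy
      obtain ⟨x, hx, rfl⟩ := ih y hy
      obtain ⟨x', hx', rfl⟩ := hD x hx
      exact ⟨x', hx', by rw [← pow_mul, ← pow_succ']⟩
  -- Step 5: lift `z` to `c ∈ R ∩ [F, F]`, write `c ≡ x^{p^a}` with `x ∈ M̃ ⊆ R̃`, and map to `E`.
  have hzmap : z ∈ (commutator (FreeGroup E)).map φ := by
    rw [map_commutator_eq, MonoidHom.range_eq_top.mpr hφ, ← commutator_def]
    exact hzc
  obtain ⟨c, hcc, hcz⟩ := Subgroup.mem_map.mp hzmap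
  have hcR : c ∈ R := by
    show π (φ c) = 1
    rw [hcz, hz]
  let φt : FreeGroup E ⧸ C →* E := QuotientGroup.lift C φ hCφ
  have hcMt : mk c ∈ Mt := Subgroup.mem_map_of_mem mk (Subgroup.mem_inf.mpr ⟨hcR, hcc⟩)
  obtain ⟨x, hx, hxc⟩ := hDa a (mk c) hcMt
  obtain ⟨f, hf, rfl⟩ := Subgroup.mem_map.mp hx
  have hfR : π (φ f) = 1 := (Subgroup.mem_inf.mp hf).1
  calc z = φ c := hcz.symm
    _ = φt (mk c) := rfl
    _ = φt (mk f ^ p ^ a) := by rw [hxc]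
    _ = φ f ^ p ^ a := by rw [map_pow]; rfl
    _ = 1 := hexp _ hfR

/-- **Exponent lifting with a distinguished generator.**  Let `G` be a group, `p ≠ 0`, `a b ∈ G` and
`m n : ℕ` with `⁅a ^ m, b ^ n⁆ = 1`.  For a central extension `π : E ↠ G` and lifts `t, l` of `a, b` put
`β := ⁅t ^ m, l ^ n⁆ ∈ ker π`.  If for EVERY central extension of `G` with kernel of exponent dividing `p`
and every choice of lifts, `ker π ∩ [E, E] ⊆ ⟨β⟩`, then the same holds for every central extension with kernel
of exponent dividing `p ^ a`.  Same Hopf-formula argument as `eq_one_of_forall_exponent`: in the free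
presentation `β` is itself a commutator, so `M := (R ∩ [F,F])/[F,R]` satisfies `M ⊆ ⟨β⟩·M^p`, hence
`M ⊆ ⟨β⟩·M^{p^a}`. [cite: Rotman1995, Ch. 11, Hopf's formula M(Q) ≅ (R ∩ F')/[F,R]] -/
theorem mem_zpowers_of_forall_exponent {G : Type v} [Group G] {p : ℕ} (hp : p ≠ 0) {a₀ b₀ : G}
    {m n : ℕ} (hab : ⁅a₀ ^ m, b₀ ^ n⁆ = 1)
    (H : ∀ (E : Type u) [Group E] (π : E →* G), Function.Surjective π →
      (∀ z : E, π z = 1 → ∀ g : E, g * z = z * g) → (∀ z : E, π z = 1 → z ^ p = 1) →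
      ∀ (t l : E), π t = a₀ → π l = b₀ →
      ∀ z : E, π z = 1 → z ∈ commutator E → z ∈ Subgroup.zpowers ⁅t ^ m, l ^ n⁆)
    {E : Type u} [Group E] (π : E →* G) (hsurj : Function.Surjective π)
    (hcen : ∀ z : E, π z = 1 → ∀ g : E, g * z = z * g) (a : ℕ)
    (hexp : ∀ z : E, π z = 1 → z ^ (p ^ a) = 1) (t l : E) (ht : π t = a₀) (hl : π l = b₀) {z : E}
    (hz : π z = 1) (hzc : z ∈ commutator E) : z ∈ Subgroup.zpowers ⁅t ^ m, l ^ n⁆ := by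
  -- Step 0: the free presentation `φ : F = FreeGroup E ↠ E`, `ρ = π ∘ φ : F ↠ G`, `R = ker ρ`, `C = [F, R]`.
  let φ : FreeGroup E →* E := FreeGroup.lift id
  have hφ : Function.Surjective φ := fun x ↦ ⟨FreeGroup.of x, FreeGroup.lift_apply_of⟩
  have hφof : ∀ x : E, φ (FreeGroup.of x) = x := fun x ↦ FreeGroup.lift_apply_of
  let ρ : FreeGroup E →* G := π.comp φ
  have hρ : Function.Surjective ρ := hsurj.comp hφ
  let R : Subgroup (FreeGroup E) := ρ.ker
  haveI hRn : R.Normal := MonoidHom.normal_ker ρ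
  let C : Subgroup (FreeGroup E) := ⁅(⊤ : Subgroup (FreeGroup E)), R⁆
  haveI hCn : C.Normal := Subgroup.commutator_normal ⊤ R
  have hCR : C ≤ R := Subgroup.commutator_le_right ⊤ R
  have hCcomm : C ≤ commutator (FreeGroup E) := by
    rw [commutator_def]
    exact Subgroup.commutator_mono le_top le_top
  have hCφ : C ≤ φ.ker := by
    show ⁅(⊤ : Subgroup (FreeGroup E)), R⁆ ≤ φ.ker
    rw [Subgroup.commutator_le]
    intro f _ r hr
    have hr' : π (φ r) = 1 := hr
    rw [MonoidHom.mem_ker, map_commutatorElement, commutatorElement_def, hcen (φ r) hr' (φ f),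
      mul_inv_cancel_right, mul_inv_cancel]
  -- the distinguished element `β_F = ⁅(of t)^m, (of l)^n⁆ ∈ R ∩ [F, F]`
  let tF : FreeGroup E := FreeGroup.of t
  let lF : FreeGroup E := FreeGroup.of l
  let βF : FreeGroup E := ⁅tF ^ m, lF ^ n⁆
  have hβφ : φ βF = ⁅t ^ m, l ^ n⁆ := by
    show φ ⁅tF ^ m, lF ^ n⁆ = _
    rw [map_commutatorElement, map_pow, map_pow, hφof, hφof]
  have hβR : βF ∈ R := by
    show π (φ βF) = 1
    rw [hβφ, map_commutatorElement, map_pow, map_pow, ht, hl, hab]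
  have hβcomm : βF ∈ commutator (FreeGroup E) := by
    rw [commutator_def]
    exact Subgroup.commutator_mem_commutator (Subgroup.mem_top _) (Subgroup.mem_top _)
  -- Step 1: `F̃ = F / C`, in which `R̃ = R / C` is central.
  let mk : FreeGroup E →* FreeGroup E ⧸ C := QuotientGroup.mk' C
  let Rt : Subgroup (FreeGroup E ⧸ C) := R.map mk
  have hRt_central : ∀ x ∈ Rt, ∀ y : FreeGroup E ⧸ C, y * x = x * y := by
    intro x hx y
    obtain ⟨r, hr, rfl⟩ := Subgroup.mem_map.mp hx
    obtain ⟨f, rfl⟩ := QuotientGroup.mk'_surjective C y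
    rw [← map_mul, ← map_mul]
    show ((f * r : FreeGroup E) : FreeGroup E ⧸ C) = ((r * f : FreeGroup E) : FreeGroup E ⧸ C)
    rw [QuotientGroup.eq]
    have h : (f * r)⁻¹ * (r * f) = ⁅r⁻¹, f⁻¹⁆ := by
      rw [commutatorElement_def]
      group
    rw [h]
    show ⁅r⁻¹, f⁻¹⁆ ∈ ⁅(⊤ : Subgroup (FreeGroup E)), R⁆
    rw [Subgroup.commutator_comm]
    exact Subgroup.commutator_mem_commutator (R.inv_mem hr) (Subgroup.mem_top _)
  -- Step 2: the subgroup `P = R̃^p` of `p`-th powers, normal in `F̃`.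
  let P : Subgroup (FreeGroup E ⧸ C) :=
    { carrier := {y | ∃ x ∈ Rt, x ^ p = y}
      one_mem' := ⟨1, one_mem _, one_pow _⟩
      mul_mem' := by
        rintro _ _ ⟨x, hx, rfl⟩ ⟨y, hy, rfl⟩
        refine ⟨x * y, mul_mem hx hy, ?_⟩
        have hc : Commute x y := (hRt_central y hy x)
        exact hc.mul_pow p
      inv_mem' := by
        rintro _ ⟨x, hx, rfl⟩
        exact ⟨x⁻¹, inv_mem hx, by rw [inv_pow]⟩ }
  have hPmem : ∀ y, y ∈ P ↔ ∃ x ∈ Rt, x ^ p = y := fun y ↦ Iff.rfl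
  haveI hPn : P.Normal := ⟨by
    intro y hy g
    obtain ⟨x, hx, rfl⟩ := (hPmem y).mp hy
    refine (hPmem _).mpr ⟨x, hx, ?_⟩
    rw [hRt_central _ (pow_mem hx p) g, mul_inv_cancel_right]⟩
  -- Step 3: `ρ₁ : F̃ / P → G` is a central extension with kernel of exponent `p`; lifts `t₁, l₁` of `a₀, b₀`.
  have hCρ : C ≤ ρ.ker := hCR
  let ρt : FreeGroup E ⧸ C →* G := QuotientGroup.lift C ρ hCρ
  have hρt : ∀ f, ρt (mk f) = ρ f := fun f ↦ rfl
  have hker_ρt : ∀ y, ρt y = 1 → y ∈ Rt := by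
    intro y hy
    obtain ⟨f, rfl⟩ := QuotientGroup.mk'_surjective C y
    exact Subgroup.mem_map.mpr ⟨f, by rw [hρt] at hy; exact hy, rfl⟩
  have hPρt : P ≤ ρt.ker := by
    intro y hy
    obtain ⟨x, hx, rfl⟩ := (hPmem y).mp hy
    obtain ⟨f, hf, rfl⟩ := Subgroup.mem_map.mp hx
    have hf' : ρ f = 1 := hf
    rw [MonoidHom.mem_ker, map_pow, hρt, hf', one_pow]
  let ρ₁ : (FreeGroup E ⧸ C) ⧸ P →* G := QuotientGroup.lift P ρt hPρt
  have h1surj : Function.Surjective ρ₁ := by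
    intro g
    obtain ⟨f, rfl⟩ := hρ g
    exact ⟨QuotientGroup.mk' P (mk f), rfl⟩
  have h1cen : ∀ w, ρ₁ w = 1 → ∀ g, g * w = w * g := by
    intro w hw g
    obtain ⟨y, rfl⟩ := QuotientGroup.mk'_surjective P w
    obtain ⟨y', rfl⟩ := QuotientGroup.mk'_surjective P g
    rw [← map_mul, ← map_mul, hRt_central y (hker_ρt y hw) y']
  have h1exp : ∀ w, ρ₁ w = 1 → w ^ p = 1 := by
    intro w hw
    obtain ⟨y, rfl⟩ := QuotientGroup.mk'_surjective P w
    rw [← map_pow, QuotientGroup.mk'_apply, QuotientGroup.eq_one_iff]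
    exact (hPmem _).mpr ⟨y, hker_ρt y hw, rfl⟩
  have ht₁ : ρ₁ (QuotientGroup.mk' P (mk tF)) = a₀ := by
    show π (φ (FreeGroup.of t)) = a₀
    rw [hφof, ht]
  have hl₁ : ρ₁ (QuotientGroup.mk' P (mk lF)) = b₀ := by
    show π (φ (FreeGroup.of l)) = b₀
    rw [hφof, hl]
  have hβ₁ : ⁅QuotientGroup.mk' P (mk tF) ^ m, QuotientGroup.mk' P (mk lF) ^ n⁆ =
      QuotientGroup.mk' P (mk βF) := by
    show _ = QuotientGroup.mk' P (mk ⁅tF ^ m, lF ^ n⁆)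
    rw [map_commutatorElement, map_commutatorElement, map_pow, map_pow, map_pow, map_pow]
  -- Step 4: `M̃ := (R ∩ [F,F]) / C` satisfies `M̃ ⊆ ⟨β̃⟩ · M̃^p`, hence `M̃ ⊆ ⟨β̃⟩ · M̃^{p^k}` for all `k`.
  let Mt : Subgroup (FreeGroup E ⧸ C) := (R ⊓ commutator (FreeGroup E)).map mk
  have hβMt : mk βF ∈ Mt := Subgroup.mem_map_of_mem mk (Subgroup.mem_inf.mpr ⟨hβR, hβcomm⟩)
  have hMtRt : Mt ≤ Rt := Subgroup.map_mono inf_le_left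
  have hD : ∀ y ∈ Mt, ∃ (j : ℤ) (x : FreeGroup E ⧸ C), x ∈ Mt ∧ mk βF ^ j * x ^ p = y := by
    intro y hy
    obtain ⟨c, hc, rfl⟩ := Subgroup.mem_map.mp hy
    obtain ⟨hcR, hcc⟩ := Subgroup.mem_inf.mp hc
    have hw1 : ρ₁ (QuotientGroup.mk' P (mk c)) = 1 := hcR
    have hwc : QuotientGroup.mk' P (mk c) ∈ commutator ((FreeGroup E ⧸ C) ⧸ P) := by
      have h := Subgroup.mem_map_of_mem ((QuotientGroup.mk' P).comp mk) hcc
      rw [map_commutator_eq] at h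
      exact Subgroup.commutator_mono le_top le_top h
    have hw := H _ ρ₁ h1surj h1cen h1exp _ _ ht₁ hl₁ _ hw1 hwc
    rw [hβ₁, Subgroup.mem_zpowers_iff] at hw
    obtain ⟨j, hj⟩ := hw
    -- `mk c * (mk βF ^ j)⁻¹ ∈ P`
    have hP : (mk βF ^ j)⁻¹ * mk c ∈ P := by
      rw [← QuotientGroup.eq_one_iff, ← QuotientGroup.mk'_apply, map_mul, map_inv, map_zpow, hj,
        inv_mul_cancel]
    obtain ⟨x, hx, hxc⟩ := (hPmem _).mp hP
    obtain ⟨f, hfR, rfl⟩ := Subgroup.mem_map.mp hx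
    refine ⟨j, mk f, Subgroup.mem_map_of_mem mk (Subgroup.mem_inf.mpr ⟨hfR, ?_⟩), ?_⟩
    · -- `f ∈ [F, F]`: `f^p ≡ βF^{-j} c (mod C)`, everything on the right is in `[F,F]`, `F^{ab}` torsion-free.
      have h1 : (f ^ p)⁻¹ * ((βF ^ j)⁻¹ * c) ∈ C := by
        rw [← QuotientGroup.eq]
        have h' : mk (f ^ p) = mk ((βF ^ j)⁻¹ * c) := by
          rw [map_pow, hxc, map_mul, map_inv, map_zpow]
        exact h'
      have h2 : f ^ p ∈ commutator (FreeGroup E) := by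
        have h3 := hCcomm h1
        have h5 : (βF ^ j)⁻¹ * c ∈ commutator (FreeGroup E) :=
          mul_mem (inv_mem (Subgroup.zpow_mem _ hβcomm j)) hcc
        have h4 : f ^ p = ((βF ^ j)⁻¹ * c) * ((f ^ p)⁻¹ * ((βF ^ j)⁻¹ * c))⁻¹ := by group
        rw [h4]
        exact mul_mem h5 (inv_mem h3)
      have h5 : Abelianization.of f ^ p = (1 : Abelianization (FreeGroup E)) := by
        rw [← map_pow, ← MonoidHom.mem_ker, Abelianization.ker_of]
        exact h2
      have h6 : f ∈ (Abelianization.of : FreeGroup E →* Abelianization (FreeGroup E)).ker :=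
        pow_eq_one_abelianization_freeGroup hp h5
      rwa [Abelianization.ker_of] at h6
    · rw [hxc, mul_inv_cancel_left]
  have hDa : ∀ k : ℕ, ∀ y ∈ Mt, ∃ (j : ℤ) (x : FreeGroup E ⧸ C), x ∈ Mt ∧ mk βF ^ j * x ^ (p ^ k) = y := by
    intro k
    induction k with
    | zero =>
      intro y hy
      exact ⟨0, y, hy, by rw [zpow_zero, one_mul, pow_zero, pow_one]⟩
    | succ k ih =>
      intro y hy
      obtain ⟨j, x, hx, rfl⟩ := ih y hy
      obtain ⟨j', x', hx', rfl⟩ := hD x hx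
      refine ⟨j + j' * p ^ k, x', hx', ?_⟩
      -- everything lives in the central subgroup `Rt`, so the factors commute
      have hcomm : Commute (mk βF ^ j') (x' ^ p) :=
        (hRt_central _ (hMtRt (Subgroup.pow_mem _ hx' p)) _)
      rw [hcomm.mul_pow, ← pow_mul, ← pow_succ', zpow_add, mul_assoc, ← zpow_natCast (mk βF ^ j'),
        ← zpow_mul, Nat.cast_pow]
  -- Step 5: lift `z` to `c ∈ R ∩ [F, F]`, write `c ≡ β^j x^{p^a}` with `x ∈ M̃ ⊆ R̃`, and map to `E`.
  have hzmap : z ∈ (commutator (FreeGroup E)).map φ := by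
    rw [map_commutator_eq, MonoidHom.range_eq_top.mpr hφ, ← commutator_def]
    exact hzc
  obtain ⟨c, hcc, hcz⟩ := Subgroup.mem_map.mp hzmap
  have hcR : c ∈ R := by
    show π (φ c) = 1
    rw [hcz, hz]
  let φt : FreeGroup E ⧸ C →* E := QuotientGroup.lift C φ hCφ
  have hcMt : mk c ∈ Mt := Subgroup.mem_map_of_mem mk (Subgroup.mem_inf.mpr ⟨hcR, hcc⟩)
  obtain ⟨j, x, hx, hxc⟩ := hDa a (mk c) hcMt
  obtain ⟨f, hf, rfl⟩ := Subgroup.mem_map.mp hx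
  have hfR : π (φ f) = 1 := (Subgroup.mem_inf.mp hf).1
  have hφtβ : φt (mk βF) = ⁅t ^ m, l ^ n⁆ := hβφ
  rw [Subgroup.mem_zpowers_iff]
  refine ⟨j, ?_⟩
  calc ⁅t ^ m, l ^ n⁆ ^ j = φt (mk βF) ^ j * φ f ^ p ^ a := by rw [hφtβ, hexp _ hfR, mul_one]
    _ = φt (mk βF ^ j * mk f ^ p ^ a) := by rw [map_mul, map_zpow, map_pow]; rfl
    _ = φt (mk c) := by rw [hxc]
    _ = φ c := rfl
    _ = z := hcz

end CentralExtensionExponentLift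

end Literature.GroupTheory
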